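import Summits.CriticalPhenomena.PercolationContinuityZ3.Theorems.Transplant.PlanarSkeletonFrmFromDefs
import Summits.CriticalPhenomena.PercolationContinuityZ3.Theorems.Transplant.SkelFrmFromBChoiceRootRunY
import Summits.CriticalPhenomena.PercolationContinuityZ3.Theorems.Transplant.SkelFrmBChoiceRootRunY
import HarnessLib
import Summits.CriticalPhenomena.PercolationContinuityZ3.Theorems.Transplant.SkelFrmBChoiceRootBoxY
/-!
# U-WAVE PORT (RULING D-U, lead g21 2026-08-26; WAVE-U-MANIFEST v3.0 row «SkelFrmBChoiceRootBoxY» ↦ «SkelFrmFromBChoiceRootBoxY») of the tree module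
# `Transplant/SkelFrmBChoiceRootBoxY` onto the carrier `PlanarSkeletonFrmFrom` (frames only, cylinders connected from width `ℓ₀` on)

ORIGINAL TITLE: N2 (frames-only node `SamePDropOfSkeletonFrm₁`, OPEN), (R) column SECOND axis — **THE ROOT y′-ARRIVAL BOX AGAINST (C)'s, ACROSS** and the

builds on p205010 (kernel theorem, internal audit signed; external expert review pending) — nothing in this file uses p205010; NOTHING is claimed about the
OPEN node U `SamePDropOfSkeletonFrmFrom₁` (nor U_s / the end state).  Lane `prim-bschramm`, seat `prim-hp-8 gen 53 (U-wave port pen, family P-hp8; tool of record = p3-g26 port_u.py)`; helper file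
(`--supports stmt-CriticalPhenomena-4575 --as helper`).  PORT RULES r1–r4 of RULING D-U: declaration order and proof texts are those of the original,
byte-identical except (i) the carrier token `PlanarSkeletonFrm ↦ PlanarSkeletonFrmFrom` (binders, `namespace`/`end` lines, qualified names of twinned
declarations), (ii) carrier-FREE declarations of the original (φ-level `Skelφ…` blocks and namespace-only arithmetic residents) are NOT re-declared —
this file imports the original and `export`s the twin-free residents (POLICY T / treatment (m1)); residents whose statement mentions a twinned
constant are copied, (iii) every carrier-binding declaration keeps its explicit binder `(Φ : PlanarSkeletonFrmFrom G)` in its own signature (r2).  Docstrings and citations are the original's.  Manifest row idx 144 (level 17; flags verbatim|MIXED(m1)); filed by the hp-8 lineage under RULING M-11 (family P-hp8).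
-/

noncomputable section

open scoped Classical

namespace Summit.CriticalPhenomena.PercolationContinuityZ3.Theorems.Transplant

namespace Skelφ

open Literature.Probability.Percolation Literature.Probability.LatticeModels SimpleGraph

section Shift

variable {V : Type} {φ : V → Site 2}

end Shift

end Skelφ

namespace PlanarSkeletonFrmFrom

namespace NegB

open Literature.Probability.Percolation Literature.Probability.LatticeModels SimpleGraph
open SkelConc (Consts)
open Skelφ (shearUnit kgSL kgSLY KGYRows kgXY kgM₁Y kgM₂Y kgCtr2Y kgHw2Y kgDec₁Y)
open Neg

namespace KS

section BoxY

variable (κ : Consts) {V : Type} [DecidableEq V] [Countable V] {G : SimpleGraph V} [G.LocallyFinite] (Φ : PlanarSkeletonFrmFrom G) (t : V) (p : unitInterval)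
  (D : Skelφ.StepI.DataNS V) (mk g f qxY WxY : ℕ)

/-- **ACROSS CONTAINMENT**: the root's y′-arrival box across corners, shifted by `X2R`, satisfy `arrLo₀^C − 2·n_L ≤ X2R + lo₀^R` and
`X2R + hi₀^R ≤ arrHi₀^C + n_L` (`2X2R + Ctr2^R ∈ [Ctr2^C − (n_L + dec₁Y − 1), Ctr2^C + dec₁Y − 1]`, `Hw2^R ≤ Hw2^C + dec₁Y − 1`, `dec₁Y ≤ n_L`).
[this work] -/
theorem rootBoxY_across_R (κ : Consts) {V : Type} [DecidableEq V] [Countable V] {G : SimpleGraph V} [G.LocallyFinite] (Φ : PlanarSkeletonFrmFrom G) (t : V) (p : unitInterval) (D : Skelφ.StepI.DataNS V) (mk : ℕ) (g : ℕ) (f : ℕ) (qxY : ℕ) (WxY : ℕ) (hN : EqNumL κ Φ t p D g f) (hg : gFloorKG κ Φ t p D mk ≤ g) (hg2 : 40 * Neg.K κ * KS0.R'0 κ Φ t p D mk ≤ g)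
    (hWxY : KS.Rs t D mk + 34 * nL κ Φ t p D g f + 29 * KS0.R'0 κ Φ t p D mk + 2 ≤ WxY) (hWx : WxY ≤ 100 * nL κ Φ t p D g f) :
    ((kgYRows0_of κ Φ t p D g f mk qxY WxY hN hg).kgLastLoY (kgNYv0 κ Φ t p D g f mk qxY WxY)) 0 - 2 * (nL κ Φ t p D g f : ℤ) ≤ (((KS.X2R κ Φ t p D mk g f WxY) : ℕ) : ℤ) + ((kgYRows0_of κ Φ t p D g f mk qxY (KS.WxYR κ Φ t p D mk g f WxY) hN hg).kgLastLoY (kgNYv0 κ Φ t p D g f mk qxY WxY)) 0 ∧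
    (((KS.X2R κ Φ t p D mk g f WxY) : ℕ) : ℤ) + ((kgYRows0_of κ Φ t p D g f mk qxY (KS.WxYR κ Φ t p D mk g f WxY) hN hg).kgLastHiY (kgNYv0 κ Φ t p D g f mk qxY WxY)) 0 ≤ ((kgYRows0_of κ Φ t p D g f mk qxY WxY hN hg).kgLastHiY (kgNYv0 κ Φ t p D g f mk qxY WxY)) 0 + (nL κ Φ t p D g f : ℤ) := by
  have hup := ctr2Y_R_le κ Φ t p D mk g f WxY hN hg hg2 hWxY hWx (kgNYv0 κ Φ t p D g f mk qxY WxY)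
  have hlo := le_ctr2Y_R κ Φ t p D mk g f WxY hN hg hWxY (kgNYv0 κ Φ t p D g f mk qxY WxY)
  have hhw := hw2Y_R_le κ Φ t p D mk g f qxY WxY hN hg (kgNYv0 κ Φ t p D g f mk qxY WxY)
  have hd : (kgDec₁Y (nL κ Φ t p D g f) (kgR κ Φ t p D mk) 0) ≤ (nL κ Φ t p D g f : ℤ) := by
    unfold kgDec₁Y; have : (0 : ℤ) ≤ (((kgR κ Φ t p D mk) : ℕ) : ℤ) := by positivity
    push_cast; linarith
  have hd1 : 1 ≤ (kgDec₁Y (nL κ Φ t p D g f) (kgR κ Φ t p D mk) 0) := by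
    have := (kgYRows0_of κ Φ t p D g f mk qxY (KS.WxYR κ Φ t p D mk g f WxY) hN hg).dec₁_pos.1
    have : (0 : ℤ) ≤ (((kgR κ Φ t p D mk) : ℕ) : ℤ) := by positivity
    push_cast at *; linarith
  have hhw0 : 0 ≤ (kgHw2Y (nL κ Φ t p D g f) (ℓL κ Φ t p D g f) (hL κ Φ t p D g f) (vL κ Φ t p D g f) (kgR κ Φ t p D mk) 0 (kgqY κ Φ t p D g f qxY) (kgWY κ Φ t p D g f (KS.WxYR κ Φ t p D mk g f WxY)) (kgNYv0 κ Φ t p D g f mk qxY WxY)) := by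
    unfold kgHw2Y
    have : (0 : ℤ) ≤ (((kgR κ Φ t p D mk) : ℕ) : ℤ) := by positivity
    have : (0 : ℤ) ≤ |(vL κ Φ t p D g f)| := abs_nonneg _
    positivity
  simp only [KGYRows.kgLastLoY, KGYRows.kgLastHiY, Matrix.cons_val_zero]
  constructor <;> omega

/-- **ALONG TOP**: the root's y′-arrival far edge is at most (C)'s (`XY^R ≤ XY^C`). [this work] -/
theorem rootBoxY_top_R (κ : Consts) {V : Type} [DecidableEq V] [Countable V] {G : SimpleGraph V} [G.LocallyFinite] (Φ : PlanarSkeletonFrmFrom G) (t : V) (p : unitInterval) (D : Skelφ.StepI.DataNS V) (mk : ℕ) (g : ℕ) (f : ℕ) (qxY : ℕ) (WxY : ℕ) (hN : EqNumL κ Φ t p D g f) (hg : gFloorKG κ Φ t p D mk ≤ g) :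
    ((kgYRows0_of κ Φ t p D g f mk qxY (KS.WxYR κ Φ t p D mk g f WxY) hN hg).kgLastHiY (kgNYv0 κ Φ t p D g f mk qxY WxY)) 1 ≤ ((kgYRows0_of κ Φ t p D g f mk qxY WxY hN hg).kgLastHiY (kgNYv0 κ Φ t p D g f mk qxY WxY)) 1 := by
  have hmono := (kgYRows0_of κ Φ t p D g f mk qxY (KS.WxYR κ Φ t p D mk g f WxY) hN hg).kgXY_mono_qW le_rfl (kgWY_R_le κ Φ t p D mk g f WxY) (kgNYv0 κ Φ t p D g f mk qxY WxY)
  simp only [KGYRows.kgLastHiY, Matrix.cons_val_one, Matrix.cons_val_zero]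
  linarith

end BoxY

end KS

end NegB

end PlanarSkeletonFrmFrom

end Summit.CriticalPhenomena.PercolationContinuityZ3.Theorems.Transplant

end
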